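import Summits.BirchSwinnertonDyer.Rank1Residual.X11b.IntSeriesComposition
import HarnessLib

/-!
# X11b · S29 K2a-2: the FORMAL ALGEBRA of the squaring equation `h² = h ∘ [2]` in `K⟦T⟧`
# (`K` any field of characteristic `0`; `[2] = (1 + T)² − 1`)

HONEST FRAMING (cell `b2b-bsdres`, run/shared/lean/b2b/bsd-rank1-residual/, verbatim in every
file): the goal of the cell is to DELETE the COMBINATION-SHAPED residual classes of the
Birch–Swinnerton-Dyer formula for ALL analytic-rank `≤ 1` elliptic curves over `ℚ` — assembled
STRICTLY from published theorems — so that the rank-`≤ 1` remainder becomes exactly the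
CONSTRUCTION-SHAPED classes, which are TYPED, NOT attempted. This is not "finishing BSD". Team
`x11b3` = N8/O2 (X11b at `p = 3`): research routes; nothing booked; no label change; O2 OPEN; the
node of record `Three.HsiehDescentAt₃` is UNCHANGED by this file (S29 RE-EXPRESSES (t) ⟸ (VR);
lead GEN 8 R9-8 / R9-10 / R9-11). THEOREMS ONLY (no definition, no named fact, no `sorry`).

PROVENANCE: S29 (x11b3-p7's "(n2)-by-values road", `HOME/b2b-bsdres-x11b3-p7/s25/S29-SIGMA-VALUES-ROAD.md`
step (R)), kernel package K2a = the FORMAL half of the rigidity step, seat `b2b-bsdres-x11b3-p3`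
GEN 7 (`HOME/b2b-bsdres-x11b3-p3/gen7/K2-INTERFACE-DRAFT.md`; consumer consent x11b3-p7, INBOX
l.4622). The ANALYTIC half (K2b: the exponent `[T¹]h` lies in `ℤ_p`) is a separate package.

## What is proved (generic field `K`, `CharZero K`; `∘` = Mathlib `PowerSeries.subst`)

* `powMapTwo_eq` (`[2] = X·(X + 2)`), `constantCoeff_powMapTwo`, `hasSubst_powMapTwo`,
  `constantCoeff_subst_of_constantCoeff_eq_zero` (`(f ∘ b)(0) = f(0)` when `b(0) = 0`), `subst_C'`,
  `eq_and_eq_of_X_pow_mul_eq` (order bookkeeping `X^a U = X^b V ⇒ a = b ∧ U = V`);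
* **`exists_sq_eq_subst_two`** — from the squaring identity `P'² · (P ∘ [2]) = d · (P' ∘ [2]) · P²`
  (`P, P', d ≠ 0`): `ord P' = ord P`, `d · [T^m]P = [T^m]P'` (so `d` is forced), and
  `P' = d · h · P` with `h(0) = 1`, `h² = h ∘ [2]`;
* **`eq_one_of_sq_eq_subst_two`**, **`eq_of_sq_eq_subst_two`** — UNIQUENESS: a solution of
  `X² = X ∘ [2]` with `X(0) = 1` is determined by `[T¹]X` (constant terms of
  `2r + Tⁿr² = (T + 2)ⁿ (r ∘ [2])` give `(2ⁿ − 2)·r(0) = 0`).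

References: [Castella2018] §2.2 (`1 + T ↦ γ`; the point of `χ^m` is `[m]` of the point of `χ`);
Mathlib `RingTheory/PowerSeries/Substitution`, `…/Order`, `…/Inverse`.
-/

noncomputable section

open scoped Classical
open PowerSeries

namespace Summit.BirchSwinnertonDyer.Rank1Residual.X11b

/-! ### §B The formal algebra of the squaring equation `h² = h ∘ [2]` over a field of characteristic 0 -/

section Formal

variable {K : Type*} [Field K] [CharZero K]

omit [CharZero K] in
/-- `[2] = (1 + X)² − 1 = X·(X + 2)`. [folklore] -/
theorem powMapTwo_eq : ((1 + X : PowerSeries K) ^ 2 - 1) = X * (X + C (2 : K)) := by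
  have : (C (2 : K) : PowerSeries K) = 2 := map_ofNat C 2
  rw [this]; ring

/-- `[2](0) = 0` (any commutative ring). [folklore] -/
theorem constantCoeff_powMapTwo {R : Type*} [CommRing R] :
    constantCoeff (((1 + X : PowerSeries R) ^ 2) - 1) = 0 := by simp

/-- `[2]` is substitutable. [folklore] -/
theorem hasSubst_powMapTwo {R : Type*} [CommRing R] :
    HasSubst (((1 + X : PowerSeries R) ^ 2) - 1) :=
  HasSubst.of_constantCoeff_zero' constantCoeff_powMapTwo

/-- Substituting a series without constant term does not change the constant term:
`(f ∘ b)(0) = f(0)`. [folklore] -/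
theorem constantCoeff_subst_of_constantCoeff_eq_zero {R : Type*} [CommRing R] {b : PowerSeries R}
    (hb : constantCoeff b = 0) (f : PowerSeries R) : constantCoeff (f.subst b) = constantCoeff f := by
  rw [← coeff_zero_eq_constantCoeff_apply, coeff_subst' (HasSubst.of_constantCoeff_zero' hb) f 0,
    finsum_eq_single _ 0]
  · simp
  · intro d hd
    rw [coeff_pow_eq_zero_of_lt hb (Nat.pos_of_ne_zero hd), smul_zero]

/-- `(C r) ∘ b = C r`. [folklore] -/
theorem subst_C' {R : Type*} [CommRing R] (b : PowerSeries R) (r : R) :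
    (C r : PowerSeries R).subst b = C r := by
  rw [subst_C]
  rfl

omit [CharZero K] in
/-- Order bookkeeping: `X^a · U = X^b · V` with `U(0), V(0) ≠ 0` forces `a = b` and `U = V`.
[folklore] -/
theorem eq_and_eq_of_X_pow_mul_eq {a b : ℕ} {U V : PowerSeries K} (hU : constantCoeff U ≠ 0)
    (hV : constantCoeff V ≠ 0) (h : X ^ a * U = X ^ b * V) : a = b ∧ U = V := by
  have hU0 : U.order = 0 := by
    have := order_le (φ := U) 0 (by rwa [coeff_zero_eq_constantCoeff])
    exact le_antisymm (by simpa using this) (by simp)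
  have hV0 : V.order = 0 := by
    have := order_le (φ := V) 0 (by rwa [coeff_zero_eq_constantCoeff])
    exact le_antisymm (by simpa using this) (by simp)
  have hab : a = b := by
    have h1 := congrArg PowerSeries.order h
    rw [order_mul, order_mul, order_X_pow, order_X_pow, hU0, hV0, add_zero, add_zero] at h1
    exact_mod_cast h1
  subst hab
  exact ⟨rfl, X_pow_mul_cancel h⟩

/-- **The formal half of (R).** In `K⟦T⟧`, `K` a field of characteristic `0`, let `P, P' ≠ 0` and
`d ≠ 0` satisfy the squaring identity `P'² · (P ∘ [2]) = d · (P' ∘ [2]) · P²`. Then `P'` and `P` have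
the same order and `P' = d · h · P` for a (unique, see `eq_of_sq_eq_subst_two`) `h` with `h(0) = 1` and
`h² = h ∘ [2]`. (Strip `X^m`, cancel `(X+2)^m`, put `h := d⁻¹ P₀' P₀⁻¹`; `h(0)² = h(0) ≠ 0` forces
`h(0) = 1`, i.e. `d = P₀'(0)/P₀(0)`.) [folklore] -/
theorem exists_sq_eq_subst_two {P P' : PowerSeries K} (hP : P ≠ 0) (hP' : P' ≠ 0) {d : K} (hd : d ≠ 0)
    (hI : P' ^ 2 * P.subst (((1 + X : PowerSeries K) ^ 2) - 1) =
      C d * P'.subst (((1 + X : PowerSeries K) ^ 2) - 1) * P ^ 2) :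
    P'.order = P.order ∧ d * coeff P.order.toNat P = coeff P'.order.toNat P' ∧
      ∃ h : PowerSeries K, constantCoeff h = 1 ∧
        h ^ 2 = h.subst (((1 + X : PowerSeries K) ^ 2) - 1) ∧ P' = C d * h * P := by
  set b : PowerSeries K := ((1 + X : PowerSeries K) ^ 2) - 1 with hbdef
  have hbs : HasSubst b := hasSubst_powMapTwo
  have hb0 : constantCoeff b = 0 := constantCoeff_powMapTwo
  have hbX : b = X * (X + C (2 : K)) := powMapTwo_eq
  -- strip the orders
  set m := P.order.toNat with hm
  set m' := P'.order.toNat with hm'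
  set P₀ := divXPowOrder P with hP₀
  set P₀' := divXPowOrder P' with hP₀'
  have hPf : X ^ m * P₀ = P := X_pow_order_mul_divXPowOrder
  have hPf' : X ^ m' * P₀' = P' := X_pow_order_mul_divXPowOrder
  have hP₀0 : constantCoeff P₀ ≠ 0 := by
    rw [hP₀, constantCoeff_divXPowOrder]; exact coeff_order hP
  have hP₀'0 : constantCoeff P₀' ≠ 0 := by
    rw [hP₀', constantCoeff_divXPowOrder]; exact coeff_order hP'
  -- substitution of the factorizations
  have hsub : ∀ (n : ℕ) (F : PowerSeries K), (X ^ n * F).subst b = X ^ n * ((X + C (2 : K)) ^ n * F.subst b) := by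
    intro n F
    rw [subst_mul hbs, subst_pow hbs, subst_X hbs, hbX, mul_pow, mul_assoc]
  have hc2 : constantCoeff (X + C (2 : K)) ≠ 0 := by simp
  have h2ne : (constantCoeff ((X + C (2 : K)) ^ m) : K) ≠ 0 := by
    rw [map_pow]; exact pow_ne_zero _ hc2
  -- the identity with orders displayed: `X^(2m'+m) U = X^(m'+2m) V`
  have hI' : X ^ (2 * m' + m) * (P₀' ^ 2 * ((X + C (2 : K)) ^ m * P₀.subst b)) =
      X ^ (m' + 2 * m) * (C d * ((X + C (2 : K)) ^ m' * P₀'.subst b) * P₀ ^ 2) := by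
    rw [← hPf, ← hPf', hsub, hsub] at hI
    calc X ^ (2 * m' + m) * (P₀' ^ 2 * ((X + C (2 : K)) ^ m * P₀.subst b))
        = (X ^ m' * P₀') ^ 2 * (X ^ m * ((X + C (2 : K)) ^ m * P₀.subst b)) := by ring
      _ = C d * (X ^ m' * ((X + C (2 : K)) ^ m' * P₀'.subst b)) * (X ^ m * P₀) ^ 2 := hI
      _ = X ^ (m' + 2 * m) * (C d * ((X + C (2 : K)) ^ m' * P₀'.subst b) * P₀ ^ 2) := by ring
  have hU : constantCoeff (P₀' ^ 2 * ((X + C (2 : K)) ^ m * P₀.subst b)) ≠ 0 := by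
    simp only [map_mul, map_pow, constantCoeff_subst_of_constantCoeff_eq_zero hb0]
    exact mul_ne_zero (pow_ne_zero _ hP₀'0) (mul_ne_zero (pow_ne_zero _ hc2) hP₀0)
  have hV : constantCoeff (C d * ((X + C (2 : K)) ^ m' * P₀'.subst b) * P₀ ^ 2) ≠ 0 := by
    simp only [map_mul, map_pow, constantCoeff_subst_of_constantCoeff_eq_zero hb0, constantCoeff_C]
    exact mul_ne_zero (mul_ne_zero hd (mul_ne_zero (pow_ne_zero _ hc2) hP₀'0)) (pow_ne_zero _ hP₀0)
  obtain ⟨hmm, hUV⟩ := eq_and_eq_of_X_pow_mul_eq hU hV hI'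
  have hm_eq : m' = m := by omega
  rw [hm_eq] at hUV
  -- cancel `(X + 2)^m`
  have hX2 : ((X + C (2 : K)) ^ m : PowerSeries K) ≠ 0 := by
    intro h0
    exact h2ne (by rw [h0, map_zero])
  have hI₀ : P₀' ^ 2 * P₀.subst b = C d * P₀'.subst b * P₀ ^ 2 := by
    have : ((X + C (2 : K)) ^ m) * (P₀' ^ 2 * P₀.subst b) =
        ((X + C (2 : K)) ^ m) * (C d * P₀'.subst b * P₀ ^ 2) := by
      calc ((X + C (2 : K)) ^ m) * (P₀' ^ 2 * P₀.subst b) = P₀' ^ 2 * ((X + C (2 : K)) ^ m * P₀.subst b) := by ring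
        _ = C d * ((X + C (2 : K)) ^ m * P₀'.subst b) * P₀ ^ 2 := hUV
        _ = ((X + C (2 : K)) ^ m) * (C d * P₀'.subst b * P₀ ^ 2) := by ring
    exact mul_left_cancel₀ hX2 this
  -- the orders agree
  have horder : P'.order = P.order := by
    rw [← coe_toNat_order hP, ← coe_toNat_order hP', ← hm, ← hm', hm_eq]
  -- define `h`
  set η : K := d⁻¹ * (constantCoeff P₀' * (constantCoeff P₀)⁻¹) with hη
  set h : PowerSeries K := C d⁻¹ * P₀' * P₀⁻¹ with hh
  have hPinv : P₀ * P₀⁻¹ = 1 := PowerSeries.mul_inv_cancel P₀ hP₀0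
  have hP₀'eq : P₀' = C d * h * P₀ := by
    calc P₀' = (C d * C d⁻¹) * P₀' * (P₀ * P₀⁻¹) := by
          rw [hPinv, ← map_mul, mul_inv_cancel₀ hd, map_one, one_mul, mul_one]
      _ = C d * h * P₀ := by rw [hh]; ring
  have hP'eq : P' = C d * h * P := by
    rw [← hPf', ← hPf, hm_eq, hP₀'eq]; ring
  -- `h² = h ∘ b`
  have hsq : h ^ 2 = h.subst b := by
    have hsubP₀' : P₀'.subst b = C d * h.subst b * P₀.subst b := by
      conv_lhs => rw [hP₀'eq]
      rw [subst_mul hbs, subst_mul hbs, subst_C' b]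
    have hne : C d * C d * P₀ ^ 2 * P₀.subst b ≠ 0 := by
      refine mul_ne_zero (mul_ne_zero (mul_ne_zero ?_ ?_) (pow_ne_zero _ ?_)) ?_
      · exact fun h0 => hd (by simpa using congrArg constantCoeff h0)
      · exact fun h0 => hd (by simpa using congrArg constantCoeff h0)
      · exact fun h0 => hP₀0 (by rw [h0, map_zero])
      · intro h0
        exact hP₀0 (by rw [← constantCoeff_subst_of_constantCoeff_eq_zero hb0 P₀, h0, map_zero])
    have key : C d * C d * P₀ ^ 2 * P₀.subst b * (h ^ 2 - h.subst b) = 0 := by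
      have e1 := hI₀
      rw [hsubP₀'] at e1
      conv_lhs at e1 => rw [hP₀'eq]
      linear_combination e1
    rcases mul_eq_zero.mp key with h0 | h0
    · exact absurd h0 hne
    · exact sub_eq_zero.mp h0
  -- `h(0) = 1`
  have hh0 : constantCoeff h = η := by
    rw [hh, hη, map_mul, map_mul, constantCoeff_C, constantCoeff_inv, mul_assoc]
  have hη0 : η ≠ 0 := by
    rw [hη]
    exact mul_ne_zero (inv_ne_zero hd) (mul_ne_zero hP₀'0 (inv_ne_zero hP₀0))
  have hη1 : η = 1 := by
    have e := congrArg constantCoeff hsq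
    rw [map_pow, constantCoeff_subst_of_constantCoeff_eq_zero hb0, hh0, sq] at e
    exact mul_left_cancel₀ hη0 (by rw [e, mul_one])
  have hcoeff : d * coeff P.order.toNat P = coeff P'.order.toNat P' := by
    rw [← hm, ← hm', ← constantCoeff_divXPowOrder, ← constantCoeff_divXPowOrder, ← hP₀, ← hP₀']
    have e : d * η * constantCoeff P₀ = constantCoeff P₀' := by
      rw [hη]
      field_simp
    rw [hη1, mul_one] at e
    exact e
  exact ⟨horder, hcoeff, h, hh0.trans hη1, hsq, hP'eq⟩

/-- **Uniqueness core**: a solution `u` of `u² = u ∘ [2]` with `u(0) = 1` and `[T¹]u = 0` is `u = 1`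
(write `u = 1 + Xⁿ r`, `r(0) ≠ 0`, `n ≥ 2`; comparing constant terms of `2r + Xⁿr² = (X+2)ⁿ (r ∘ [2])`
gives `(2ⁿ − 2)·r(0) = 0`, impossible in characteristic `0`). [folklore] -/
theorem eq_one_of_sq_eq_subst_two {u : PowerSeries K} (h0 : constantCoeff u = 1) (h1 : coeff 1 u = 0)
    (hu : u ^ 2 = u.subst (((1 + X : PowerSeries K) ^ 2) - 1)) : u = 1 := by
  set b : PowerSeries K := ((1 + X : PowerSeries K) ^ 2) - 1 with hbdef
  have hbs : HasSubst b := hasSubst_powMapTwo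
  have hb0 : constantCoeff b = 0 := constantCoeff_powMapTwo
  have hbX : b = X * (X + C (2 : K)) := powMapTwo_eq
  by_contra hne
  set r₀ := u - 1 with hr₀
  have hr₀ne : r₀ ≠ 0 := sub_ne_zero.mpr hne
  set n := r₀.order.toNat with hn
  set r := divXPowOrder r₀ with hr
  have hrf : X ^ n * r = r₀ := X_pow_order_mul_divXPowOrder
  have hr0 : constantCoeff r ≠ 0 := by
    rw [hr, constantCoeff_divXPowOrder]; exact coeff_order hr₀ne
  -- `n ≥ 2`
  have hn2 : 2 ≤ n := by
    have h2 : (2 : ℕ∞) ≤ r₀.order := by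
      refine nat_le_order r₀ 2 fun i hi => ?_
      interval_cases i
      · rw [coeff_zero_eq_constantCoeff, hr₀, map_sub, h0, map_one, sub_self]
      · rw [hr₀, map_sub, h1, coeff_one, if_neg one_ne_zero, sub_zero]
    have : ((2 : ℕ) : ℕ∞) ≤ (n : ℕ∞) := by
      rw [hn, coe_toNat_order hr₀ne]; exact_mod_cast h2
    exact_mod_cast this
  have hu' : u = 1 + X ^ n * r := by rw [hrf, hr₀]; ring
  -- expand both sides of `u² = u ∘ b`
  have hlhs : u ^ 2 = 1 + X ^ n * (2 * r + X ^ n * r ^ 2) := by rw [hu']; ring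
  have hrhs : u.subst b = 1 + X ^ n * ((X + C (2 : K)) ^ n * r.subst b) := by
    have h1sub : (1 : PowerSeries K).subst b = 1 := by
      rw [← map_one C, subst_C' b (1 : K)]
    have hbn : b ^ n = X ^ n * (X + C (2 : K)) ^ n := by rw [hbX, mul_pow]
    rw [hu', subst_add hbs, subst_mul hbs, subst_pow hbs, subst_X hbs, h1sub, hbn]
    ring
  have hcore : 2 * r + X ^ n * r ^ 2 = (X + C (2 : K)) ^ n * r.subst b := by
    have e : X ^ n * (2 * r + X ^ n * r ^ 2) = X ^ n * ((X + C (2 : K)) ^ n * r.subst b) := by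
      have := hu
      rw [hlhs, hrhs] at this
      exact add_left_cancel this
    exact X_pow_mul_cancel e
  -- constant terms: `2 r(0) = 2ⁿ r(0)`
  have hconst := congrArg constantCoeff hcore
  have hn0 : n ≠ 0 := by omega
  simp only [map_add, map_mul, map_pow, constantCoeff_X, zero_pow hn0, zero_mul, add_zero,
    map_ofNat, zero_add, constantCoeff_subst_of_constantCoeff_eq_zero hb0] at hconst
  -- `(2 - 2^n) r(0) = 0` with `2 - 2^n ≠ 0`
  have h22 : (2 : K) ≠ (2 : K) ^ n := by
    intro h
    have h' : ((2 : ℕ) : K) = ((2 ^ n : ℕ) : K) := by exact_mod_cast h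
    have h'' : (2 : ℕ) = 2 ^ n := by exact_mod_cast h'
    have : 2 ^ 1 < 2 ^ n := Nat.pow_lt_pow_right (by norm_num) (by omega)
    omega
  apply hr0
  have : (2 - 2 ^ n : K) * constantCoeff r = 0 := by rw [sub_mul, hconst, sub_self]
  rcases mul_eq_zero.mp this with h | h
  · exact absurd (sub_eq_zero.mp h) h22
  · exact h

/-- **Uniqueness**: two solutions `h, h'` of `X² = X ∘ [2]` with `h(0) = h'(0) = 1` and the same
linear coefficient coincide (apply the core to `u := h' · h⁻¹`). Hence the `h` of
`exists_sq_eq_subst_two` is determined by `[T¹]h`; when `[T¹]h = a ∈ ℤ_p` it is the binomial series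
`(1 + T)^a` (`binomialSeries_sq_eq_subst_two`). [folklore] -/
theorem eq_of_sq_eq_subst_two {h h' : PowerSeries K} (h0 : constantCoeff h = 1)
    (h0' : constantCoeff h' = 1) (h1 : coeff 1 h = coeff 1 h')
    (hh : h ^ 2 = h.subst (((1 + X : PowerSeries K) ^ 2) - 1))
    (hh' : h' ^ 2 = h'.subst (((1 + X : PowerSeries K) ^ 2) - 1)) : h = h' := by
  set b : PowerSeries K := ((1 + X : PowerSeries K) ^ 2) - 1 with hbdef
  have hbs : HasSubst b := hasSubst_powMapTwo
  -- the inverse `g` of `h`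
  set g : PowerSeries K := h⁻¹ with hg
  have hhg : h * g = 1 := PowerSeries.mul_inv_cancel h (by rw [h0]; exact one_ne_zero)
  have hg0 : constantCoeff g = 1 := by rw [hg, constantCoeff_inv, h0, inv_one]
  have hg1 : coeff 1 g = - coeff 1 h := by
    have e := congrArg (coeff 1) hhg
    rw [coeff_mul, Finset.Nat.antidiagonal_succ, Finset.sum_cons, Finset.Nat.antidiagonal_zero,
      Finset.map_singleton, Finset.sum_singleton, coeff_one, if_neg one_ne_zero] at e
    simp only [Function.Embedding.coe_prodMap, Function.Embedding.coeFn_mk,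
      Prod.map, Nat.succ_eq_add_one, zero_add, Function.Embedding.refl_apply,
      coeff_zero_eq_constantCoeff, h0, hg0, one_mul, mul_one] at e
    linear_combination e
  -- `g² = g ∘ b`: both are inverses of `h² = h ∘ b`
  have hsg : (h.subst b) * (g.subst b) = 1 := by
    rw [← subst_mul hbs, hhg, ← map_one C, subst_C' b (1 : K)]
  have hgsq : g ^ 2 = g.subst b := by
    have e1 : h ^ 2 * g ^ 2 = 1 := by rw [← mul_pow, hhg, one_pow]
    have e2 : h ^ 2 * g.subst b = 1 := by rw [hh, hsg]
    have hne : h ^ 2 ≠ 0 := pow_ne_zero _ (fun h00 => by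
      have := congrArg constantCoeff h00; rw [h0, map_zero] at this; exact one_ne_zero this)
    exact mul_left_cancel₀ hne (e1.trans e2.symm)
  -- `u := h' g`
  set u := h' * g with hudef
  have hu0 : constantCoeff u = 1 := by rw [hudef, map_mul, h0', hg0, mul_one]
  have hu1 : coeff 1 u = 0 := by
    rw [hudef, coeff_mul, Finset.Nat.antidiagonal_succ, Finset.sum_cons, Finset.Nat.antidiagonal_zero,
      Finset.map_singleton, Finset.sum_singleton]
    simp only [Function.Embedding.coe_prodMap, Function.Embedding.coeFn_mk,
      Prod.map, Nat.succ_eq_add_one, zero_add, Function.Embedding.refl_apply,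
      coeff_zero_eq_constantCoeff, h0', hg0, hg1, ← h1, one_mul, mul_one]
    ring
  have husq : u ^ 2 = u.subst b := by
    rw [hudef, mul_pow, hh', hgsq, ← subst_mul hbs]
  have hu := eq_one_of_sq_eq_subst_two hu0 hu1 husq
  -- `h' g = 1 = h g` ⟹ `h' = h`
  have hgne : g ≠ 0 := fun h00 => by
    have := congrArg constantCoeff h00; rw [hg0, map_zero] at this; exact one_ne_zero this
  exact (mul_right_cancel₀ hgne (hhg.trans hu.symm)).symm ▸ rfl

end Formal

end Summit.BirchSwinnertonDyer.Rank1Residual.X11b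

end
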